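import Summits.ResolutionOfSingularities.ResolutionOfSingularities.Theorems.FrobeniusClosingSteerWords01Core
import Literature.AlgebraicGeometry.Resolution.MuPTorsorLocalUniformizationRelative
import Literature.AlgebraicGeometry.Resolution.QuadraticTransformsRegular

/-!
# Crux `Steer` (stmt-ResolutionOfSingularities-16345) — (α″-tor) THE TORIC LU BRICK

OURS (campaign res-hironaka, rung L ★L-G4, slot W4.1, chain w41; res-type-028 g10 on res-L0-w41-plan-1 RULING 102b /
103 (g9), statement file `L/res-type-028/ToricConcl.statement.lean` 9bd0363194e3a210). Theses-free (imports the
hoisted words `…Theorems.FrobeniusClosingSteerWords01Core` only for `Concl`); `--supports stmt-ResolutionOfSingularities-16345`,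
counted 0. NOT a statement of the manuscript under review [claim: Hironaka2017, status: under-review]; AI seat,
weaker than expert review. Mathematical content: folklore toric geometry (a regular cone gives a polynomial chart).

WHY (res-L0-w41-tri-3 row R-O, RULING 102): on the separated toric class the steered run can be ETERNAL (specimen F,
`t² = u₁u₂²u₃⁴ + u₀³u₁⁶u₂u₃`, weights on a rank-2 ray, period 5) while the CONCLUSION `Concl O A₀ t` of the frontier
binders F-A1/F-A2 still holds — by a toric chart. This file is that chart as a lemma, so that §σ2.28's (α″) words
(«eternal in-regime birth/branch-wander ⇒ eventually toric-self-similar» = FRONTIER; «toric ⇒ Concl» = this BRICK) can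
cite it by name.

THE BRICK. `K = k(y)` is the function field of a torus: `y : Fin n → K` algebraically independent over `k` with
`Frac k[y] = K`. A valuation ring `O ⊇ k` of `K` has weight vector `ω = (ν(y_i))_i` (multiplicative convention
`O = {ν ≤ 1}`; `ν` is additive on Laurent monomials for free). A REGULAR CONE `σ ∋ ω` is a `ℤ`-basis `m₀, …, m_{n−1}`
of the character lattice — rows of `m : Matrix (Fin n) (Fin n) ℤ` with `IsUnit m.det` — whose monomials
`z_j = y^{m_j} = ∏ i, y i ^ m j i` lie in `O`. Then (T2) `z` is again algebraically independent and `k(z) = K`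
(`y_i = ∏ j, z_j ^ (m⁻¹) i j`; transcendence degree), so (T1) `B = k[z] ≅ k[X₁..X_n]` is regular (Mathlib
`IsRegularRing (MvPolynomial …)`) and its local ring `L = locAtCentre B O` at the centre of `O` is a regular local ring
(tree `isRegularLocalRing_locAtCentre_of_isRegularRing`); for every finitely generated `A₀ ⊆ L` and `t ∈ L` the model
`A := k[z, gens A₀, t]` is sandwiched `B ≤ A ≤ L`, hence `locAtCentre A O = L` (tree `locAtCentre_locAtCentre`),
`Frac A = K`, `A ⊆ O`: this is `Concl O A₀ t` LITERALLY (T3 `concl_of_toricChart`). (T4a–d) discharge the two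
membership hypotheses in practice: monomials with exponent an `ℕ`-combination of the rows (the dual cone `σ^∨`) lie in
`B`; `a · u ^ c` (`c : ℤ`) stays in `L` when `ν(u) = 1` (specimen F: `u_i = y^{d_i} (1+q)^{c_i}`, `1 + q = u^{M₂−M₁}`
of value `1`, `c₃ = −1`); `k[G] ⊆ L` when `G ⊆ L`. No characteristic, perfectness, termination or `σ_top` hypothesis.
`hk : k ⊆ O` is `algebraMap_mem_of_le O A₀ h₀` from the core binder `h₀ : A₀ ⊆ O`.

Contents: (T1) `isRegularRing_toSubring_adjoin_of_algebraicIndependent`, `isFractionRing_adjoin_of_adjoin_eq_top`,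
`concl_of_polynomialChart` · (T4b) `mul_zpow_mem_locAtCentre` · (T2) `prod_zpow_add`, `prod_zpow_sum`, `prod_zpow_mul`,
`eq_prod_monomial_zpow_of_inv_mul`, `intermediateField_adjoin_eq_top_of_isFractionRing`,
`algebraicIndependent_monomialBasis` · (T3) `concl_of_toricChart` · (T4a) `monomial_mem_adjoin_of_natCombination`,
(T4c) `adjoin_toSubring_le_locAtCentre`, (T4d) `mem_locAtCentre_of_mem_adjoin`.
-/

noncomputable section

-- single-problem summit: the doubled namespace component `ResolutionOfSingularities` is forced
set_option linter.dupNamespace false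

open scoped BigOperators

namespace Summit.ResolutionOfSingularities.ResolutionOfSingularities.Theorems.SteerToricConcl

open Summit.ResolutionOfSingularities.ResolutionOfSingularities.Theorems.SwitchingDichotomy.Words (Concl)
open Literature.AlgebraicGeometry.Resolution

variable {k K : Type} [Field k] [Field K] [Algebra k K]

/-! ## (T1) the polynomial chart -/

/-- A polynomial subalgebra `k[z]` (with `z` algebraically independent over `k`) is a regular ring; read on its
underlying subring. [folklore] -/
theorem isRegularRing_toSubring_adjoin_of_algebraicIndependent {n : ℕ} (z : Fin n → K)
    (hz : AlgebraicIndependent k z) : IsRegularRing (Algebra.adjoin k (Set.range z)).toSubring := by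
  have e₀ : MvPolynomial (Fin n) k ≃+* (Algebra.adjoin k (Set.range z) : Subalgebra k K) :=
    hz.aevalEquiv.toRingEquiv
  have e₁ : (Algebra.adjoin k (Set.range z) : Subalgebra k K) ≃+* (Algebra.adjoin k (Set.range z)).toSubring :=
    { toFun := fun a => ⟨a.1, a.2⟩
      invFun := fun a => ⟨a.1, a.2⟩
      left_inv := fun _ => rfl
      right_inv := fun _ => rfl
      map_mul' := fun _ _ => rfl
      map_add' := fun _ _ => rfl }
  haveI : IsRegularRing (MvPolynomial (Fin n) k) := inferInstance
  exact IsRegularRing.of_ringEquiv (e₀.trans e₁)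

/-- `Frac k[z] = K` when `k(z) = K`. [folklore] -/
theorem isFractionRing_adjoin_of_adjoin_eq_top {n : ℕ} (z : Fin n → K)
    (hzK : IntermediateField.adjoin k (Set.range z) = ⊤) :
    IsFractionRing (Algebra.adjoin k (Set.range z)) K := by
  refine IsFractionRing.of_field _ _ fun x => ?_
  have hx : x ∈ IntermediateField.adjoin k (Set.range z) := by rw [hzK]; exact IntermediateField.mem_top
  obtain ⟨r, hr, s, hs, hx⟩ := IntermediateField.mem_adjoin_iff_div.mp hx
  exact ⟨⟨r, hr⟩, ⟨s, hs⟩, hx⟩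

/-- **(T1) polynomial-chart form.** If `z : Fin n → K` is algebraically independent over `k`, lies in the valuation
ring `O ⊇ k`, and generates `K` as a field (`k(z) = K`), then for the local ring `L = locAtCentre k[z] O` of the
polynomial ring `k[z]` at the centre of `O`: every finitely generated `A₀ ⊆ L` and every `t ∈ L` satisfy
`Concl O A₀ t` (the model is `k[z, generators of A₀, t]`, whose local ring at the centre is `L`, a localisation of a
polynomial ring, hence regular). OURS. [folklore] -/
theorem concl_of_polynomialChart (O : ValuationSubring K) (hk : ∀ c : k, algebraMap k K c ∈ O)
    {n : ℕ} (z : Fin n → K) (hz : AlgebraicIndependent k z) (hzO : ∀ j, z j ∈ O)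
    (hzK : IntermediateField.adjoin k (Set.range z) = ⊤)
    (A₀ : Subalgebra k K) (hA₀ : A₀.FG)
    (hA₀L : A₀.toSubring ≤ locAtCentre (Algebra.adjoin k (Set.range z)).toSubring O)
    (t : K) (ht : t ∈ locAtCentre (Algebra.adjoin k (Set.range z)).toSubring O) :
    Concl O A₀ t := by
  classical
  set B : Subalgebra k K := Algebra.adjoin k (Set.range z) with hBdef
  have hBO : B.toSubring ≤ O.toSubring :=
    adjoin_toSubring_le_of_subset_valuationSubring O hk (Set.range_subset_iff.mpr hzO)
  haveI : IsRegularRing B.toSubring := isRegularRing_toSubring_adjoin_of_algebraicIndependent z hz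
  have hLreg : IsRegularLocalRing (locAtCentre B.toSubring O) :=
    isRegularLocalRing_locAtCentre_of_isRegularRing hBO
  haveI hBfr : IsFractionRing B K := isFractionRing_adjoin_of_adjoin_eq_top z hzK
  obtain ⟨s₀, hs₀⟩ := hA₀
  -- the model `A := k[z, s₀, t]`
  set G : Finset K := Finset.univ.image z ∪ (s₀ ∪ {t}) with hGdef
  set A : Subalgebra k K := Algebra.adjoin k (G : Set K) with hAdef
  have hGset : (G : Set K) = Set.range z ∪ ((s₀ : Set K) ∪ {t}) := by
    rw [hGdef, Finset.coe_union, Finset.coe_union, Finset.coe_image, Finset.coe_univ, Set.image_univ,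
      Finset.coe_singleton]
  have hAfg : A.FG := ⟨G, rfl⟩
  have hBA : B ≤ A := by
    rw [hAdef, hGset]
    exact Algebra.adjoin_mono Set.subset_union_left
  have hA₀A : A₀ ≤ A := by
    rw [← hs₀, hAdef, hGset]
    exact Algebra.adjoin_mono fun x hx => Or.inr (Or.inl hx)
  have htA : t ∈ A := by
    rw [hAdef, hGset]
    exact Algebra.subset_adjoin (Or.inr (Or.inr rfl))
  have hAL : A.toSubring ≤ locAtCentre B.toSubring O := by
    let L' : Subalgebra k K :=
      { locAtCentre B.toSubring O with
        algebraMap_mem' := fun c => le_locAtCentre _ O (B.algebraMap_mem c) }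
    have hle : A ≤ L' := by
      rw [hAdef, hGset]
      refine Algebra.adjoin_le ?_
      rintro x (⟨j, rfl⟩ | hx | hx)
      · exact le_locAtCentre _ O (Algebra.subset_adjoin ⟨j, rfl⟩ : z j ∈ B)
      · exact hA₀L (show x ∈ A₀ by rw [← hs₀]; exact Algebra.subset_adjoin hx)
      · rw [Set.mem_singleton_iff] at hx
        rw [hx]
        exact ht
    exact fun x hx => hle hx
  have hAO : A.toSubring ≤ O.toSubring := hAL.trans (locAtCentre_le hBO)
  have hloc : locAtCentre A.toSubring O = locAtCentre B.toSubring O := by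
    refine le_antisymm ?_ (locAtCentre_mono O (show B.toSubring ≤ A.toSubring from hBA))
    have h1 := locAtCentre_mono O hAL
    rwa [locAtCentre_locAtCentre] at h1
  have hAfr : IsFractionRing A K := isFractionRing_subalgebra_of_le B A hBA
  refine ⟨A, hAO, hA₀A, htA, hAfg, hAfr, ?_⟩
  have hAreg : IsRegularLocalRing (locAtCentre A.toSubring O) := by
    rw [hloc]
    exact hLreg
  exact (isRegularLocalRing_locAtCentre_iff hAO).mp hAreg

/-! ## (T4b) cone-units are invertible at the centre -/

/-- **(T4b) cone-units are invertible at the centre**: for any subring `B`, an element `a · u ^ c` (`c : ℤ`) with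
`a, u ∈ locAtCentre B O` and `O.valuation u = 1` lies in `locAtCentre B O` (tree `inv_mem_locAtCentre`). E.g. specimen
F's `u_i = y^{d_i} · (1 + q)^{c_i}` with `1 + q = u^{M₂ − M₁}` of value `1`. OURS. [folklore] -/
theorem mul_zpow_mem_locAtCentre (O : ValuationSubring K) (B : Subring K) {a u : K}
    (ha : a ∈ locAtCentre B O) (hu : u ∈ locAtCentre B O) (hvu : O.valuation u = 1) (c : ℤ) :
    a * u ^ c ∈ locAtCentre B O := by
  refine Subring.mul_mem _ ha ?_
  obtain ⟨c, rfl | rfl⟩ := c.eq_nat_or_neg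
  · rw [zpow_natCast]
    exact Subring.pow_mem _ hu c
  · rw [zpow_neg, zpow_natCast, ← inv_pow]
    exact Subring.pow_mem _ (inv_mem_locAtCentre hu hvu) c


/-! ## (T2) torus coordinates: Laurent monomials and a unimodular change of the character basis -/

/-- Laurent monomials are multiplicative in the exponent (`y_i ≠ 0`). [folklore] -/
theorem prod_zpow_add {n : ℕ} (y : Fin n → K) (hy0 : ∀ i, y i ≠ 0) (a b : Fin n → ℤ) :
    (∏ i, y i ^ (a i + b i)) = (∏ i, y i ^ a i) * ∏ i, y i ^ b i := by
  rw [← Finset.prod_mul_distrib]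
  exact Finset.prod_congr rfl fun i _ => zpow_add₀ (hy0 i) _ _

/-- Laurent monomials turn finite sums of exponents into products (`y_i ≠ 0`). [folklore] -/
theorem prod_zpow_sum {n : ℕ} (y : Fin n → K) (hy0 : ∀ i, y i ≠ 0) {ι : Type} (s : Finset ι)
    (f : ι → Fin n → ℤ) :
    (∏ i, y i ^ (∑ j ∈ s, f j i)) = ∏ j ∈ s, ∏ i, y i ^ f j i := by
  classical
  induction s using Finset.induction_on with
  | empty => simp
  | insert j s hj ih =>
    rw [Finset.prod_insert hj, ← ih, ← prod_zpow_add y hy0]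
    exact Finset.prod_congr rfl fun i _ => by rw [Finset.sum_insert hj]

/-- An integer multiple of an exponent vector gives an integer power of the monomial. [folklore] -/
theorem prod_zpow_mul {n : ℕ} (y : Fin n → K) (c : ℤ) (a : Fin n → ℤ) :
    (∏ i, y i ^ (c * a i)) = (∏ i, y i ^ a i) ^ c := by
  rw [← Finset.prod_zpow]
  exact Finset.prod_congr rfl fun i _ => by rw [mul_comm, zpow_mul]

/-- **Inverse basis change**: with `m⁻¹ * m = 1`, each coordinate `y_i` is the Laurent monomial
`∏ j, (y^{m_j}) ^ (m⁻¹ i j)` in the new monomials. [folklore] -/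
theorem eq_prod_monomial_zpow_of_inv_mul {n : ℕ} (y : Fin n → K) (hy0 : ∀ i, y i ≠ 0)
    (m minv : Matrix (Fin n) (Fin n) ℤ) (hinv : minv * m = 1) (i : Fin n) :
    y i = ∏ j, (∏ l, y l ^ m j l) ^ minv i j := by
  have h1 : y i = ∏ l, y l ^ ((1 : Matrix (Fin n) (Fin n) ℤ) i l) := by
    rw [← Finset.prod_erase_mul _ _ (Finset.mem_univ i), Matrix.one_apply_eq, zpow_one]
    rw [Finset.prod_eq_one, one_mul]
    intro l hl
    rw [Matrix.one_apply_ne (Finset.ne_of_mem_erase hl).symm, zpow_zero]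
  rw [h1, ← hinv]
  simp_rw [Matrix.mul_apply]
  rw [prod_zpow_sum y hy0 Finset.univ (fun j l => minv i j * m j l)]
  exact Finset.prod_congr rfl fun j _ => prod_zpow_mul y (minv i j) (m j)

/-- `Frac R = K` for a subalgebra `R` forces `k(R) = K`. [folklore] -/
theorem intermediateField_adjoin_eq_top_of_isFractionRing (R : Subalgebra k K) [IsFractionRing R K] :
    IntermediateField.adjoin k (R : Set K) = ⊤ := by
  refine eq_top_iff.mpr fun x _ => ?_
  obtain ⟨a, b, -, rfl⟩ := IsFractionRing.div_surjective (A := R) x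
  exact div_mem (IntermediateField.subset_adjoin _ _ a.2) (IntermediateField.subset_adjoin _ _ b.2)

/-- **(T2) torus coordinates.** For `y : Fin n → K` algebraically independent over `k` with `Frac k[y] = K` and a
`ℤ`-basis `m` of the character lattice (`IsUnit m.det`), the monomials `z_j = ∏ i, y i ^ m j i` are again
algebraically independent over `k` and generate `K` as a field (`y_i = ∏ j, z_j ^ (m⁻¹) i j`). OURS. [folklore] -/
theorem algebraicIndependent_monomialBasis {n : ℕ} (y : Fin n → K) (hy : AlgebraicIndependent k y)
    (hyK : IsFractionRing (Algebra.adjoin k (Set.range y)) K)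
    (m : Matrix (Fin n) (Fin n) ℤ) (hm : IsUnit m.det) :
    AlgebraicIndependent k (fun j => ∏ i, y i ^ m j i) ∧
      IntermediateField.adjoin k (Set.range fun j => ∏ i, y i ^ m j i) = ⊤ := by
  classical
  have hy0 : ∀ i, y i ≠ 0 := fun i => hy.ne_zero i
  set z : Fin n → K := fun j => ∏ i, y i ^ m j i with hzdef
  -- generation: every `y_i` is a Laurent monomial in the `z_j`
  have hyF : ∀ i, y i ∈ IntermediateField.adjoin k (Set.range z) := by
    intro i
    rw [eq_prod_monomial_zpow_of_inv_mul y hy0 m m⁻¹ (Matrix.nonsing_inv_mul m hm) i]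
    refine prod_mem fun j _ => zpow_mem ?_ _
    exact IntermediateField.subset_adjoin _ _ ⟨j, rfl⟩
  have htop : IntermediateField.adjoin k (Set.range z) = ⊤ := by
    haveI := hyK
    have h1 : IntermediateField.adjoin k (Set.range y) ≤ IntermediateField.adjoin k (Set.range z) :=
      IntermediateField.adjoin_le_iff.mpr (Set.range_subset_iff.mpr hyF)
    have h2 : IntermediateField.adjoin k ((Algebra.adjoin k (Set.range y) : Subalgebra k K) : Set K) ≤
        IntermediateField.adjoin k (Set.range y) :=
      IntermediateField.adjoin_le_iff.mpr (IntermediateField.algebra_adjoin_le_adjoin k _)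
    have h3 := intermediateField_adjoin_eq_top_of_isFractionRing (Algebra.adjoin k (Set.range y))
    exact eq_top_iff.mpr (h3.symm.le.trans (h2.trans h1))
  refine ⟨?_, htop⟩
  -- algebraic independence by transcendence degree
  haveI : FaithfulSMul k K := (faithfulSMul_iff_algebraMap_injective k K).mpr (algebraMap k K).injective
  haveI hyalg : Algebra.IsAlgebraic (Algebra.adjoin k (Set.range y)) K := by
    haveI := hyK
    exact IsLocalization.isAlgebraic K (nonZeroDivisors (Algebra.adjoin k (Set.range y)))
  have hyT : IsTranscendenceBasis k y := hy.isTranscendenceBasis_iff_isAlgebraic.mpr hyalg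
  have htr : Cardinal.mk (Fin n) = Algebra.trdeg k K := hyT.cardinalMk_eq_trdeg
  haveI hzalg : Algebra.IsAlgebraic (Algebra.adjoin k (Set.range z)) K := by
    haveI := isFractionRing_adjoin_of_adjoin_eq_top z htop
    exact IsLocalization.isAlgebraic K (nonZeroDivisors (Algebra.adjoin k (Set.range z)))
  exact (Algebra.IsAlgebraic.isTranscendenceBasis_of_le_trdeg_of_finite k z htr.le).1

/-! ## (T3) the toric LU brick -/

/-- **(T3) THE TORIC LU BRICK (α″-tor).** `K = k(y)` the function field of a torus (`y` algebraically independent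
over `k`, `Frac k[y] = K`), `O ⊇ k` a valuation ring of `K` with weight vector `ω = (ν(y_i))_i`, and a REGULAR CONE
`σ ∋ ω`: a `ℤ`-basis `m` of the character lattice (`IsUnit m.det`) with `y^{m_j} ∈ O` for every row `m_j`
(`⟺ O.valuation (y^{m_j}) ≤ 1`, `ValuationSubring.valuation_le_one_iff`). If the finitely generated `A₀` and the
element `t` lie in the local ring `locAtCentre k[y^{m₀}, …, y^{m_{n−1}}] O` at the centre of `O` (use (T4a/b/c):
needed monomials in `σ^∨` and inverses of cone-units do), then `Concl O A₀ t` — LITERALLY the conclusion of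
`…Words01Core` / `SteerRankThinness.Concl`: a finitely generated regular-at-the-centre model `A₀ ≤ A ≤ O ∋ t` with
`Frac A = K`. No characteristic, perfectness, termination or `σ_top` hypothesis. OURS. [folklore] -/
theorem concl_of_toricChart (O : ValuationSubring K) (hk : ∀ c : k, algebraMap k K c ∈ O)
    {n : ℕ} (y : Fin n → K) (hy : AlgebraicIndependent k y)
    (hyK : IsFractionRing (Algebra.adjoin k (Set.range y)) K)
    (m : Matrix (Fin n) (Fin n) ℤ) (hm : IsUnit m.det)
    (hmO : ∀ j, (∏ i, y i ^ m j i) ∈ O)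
    (A₀ : Subalgebra k K) (hA₀ : A₀.FG)
    (hA₀L : A₀.toSubring ≤ locAtCentre (Algebra.adjoin k (Set.range fun j => ∏ i, y i ^ m j i)).toSubring O)
    (t : K) (ht : t ∈ locAtCentre (Algebra.adjoin k (Set.range fun j => ∏ i, y i ^ m j i)).toSubring O) :
    Concl O A₀ t := by
  obtain ⟨hz, hzK⟩ := algebraicIndependent_monomialBasis y hy hyK m hm
  exact concl_of_polynomialChart O hk (fun j => ∏ i, y i ^ m j i) hz hmO hzK A₀ hA₀ hA₀L t ht

/-! ## (T4) membership helpers for the two `locAtCentre` hypotheses -/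

/-- **(T4a) needed monomials in the dual cone lie in the chart ring**: an `ℕ`-combination `a = Σ_j c_j • m_j` of the
basis rows gives `y^a = ∏ j, (y^{m_j}) ^ c_j ∈ k[y^{m₀}, …, y^{m_{n−1}}]` (`y_i ≠ 0`). OURS. [folklore] -/
theorem monomial_mem_adjoin_of_natCombination {n : ℕ} (y : Fin n → K) (hy0 : ∀ i, y i ≠ 0)
    (m : Matrix (Fin n) (Fin n) ℤ) (c : Fin n → ℕ) :
    (∏ i, y i ^ (∑ j, (c j : ℤ) * m j i)) ∈ Algebra.adjoin k (Set.range fun j => ∏ i, y i ^ m j i) := by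
  rw [prod_zpow_sum y hy0 Finset.univ (fun j i => (c j : ℤ) * m j i)]
  refine prod_mem fun j _ => ?_
  rw [prod_zpow_mul y (c j : ℤ) (m j), zpow_natCast]
  exact Subalgebra.pow_mem _ (Algebra.subset_adjoin (Set.mem_range_self j)) _

/-- **(T4c) adjoining elements of the local ring at the centre**: if `G ⊆ locAtCentre B O` for a `k`-subalgebra `B`,
then `k[G] ⊆ locAtCentre B O` (as subrings) — the form in which `A₀ = k[u₀, …]` discharges hypothesis `hA₀L` of
(T1)/(T3). OURS. [folklore] -/
theorem adjoin_toSubring_le_locAtCentre (O : ValuationSubring K) (B : Subalgebra k K) {G : Set K}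
    (hG : G ⊆ locAtCentre B.toSubring O) : (Algebra.adjoin k G).toSubring ≤ locAtCentre B.toSubring O := by
  let L' : Subalgebra k K :=
    { locAtCentre B.toSubring O with
      algebraMap_mem' := fun c => le_locAtCentre _ O (B.algebraMap_mem c) }
  have hle : Algebra.adjoin k G ≤ L' := Algebra.adjoin_le hG
  exact fun x hx => hle hx

/-- **(T4d) the chart ring itself lies in its local ring at the centre** (`le_locAtCentre`, subalgebra form): in
particular every basis monomial `y^{m_j}` and every `ℕ`-combination monomial of (T4a) is in `locAtCentre k[y^{m}] O`.
OURS. [folklore] -/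
theorem mem_locAtCentre_of_mem_adjoin (O : ValuationSubring K) (B : Subalgebra k K) {x : K} (hx : x ∈ B) :
    x ∈ locAtCentre B.toSubring O :=
  le_locAtCentre _ O hx

end Summit.ResolutionOfSingularities.ResolutionOfSingularities.Theorems.SteerToricConcl
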